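import Summits.CriticalPhenomena.PercolationContinuityZ3.Theorems.Transplant.FKConnectivityAllQPat3Skeleton
import Summits.CriticalPhenomena.PercolationContinuityZ3.Theorems.Transplant.FKConnectivityAllQPat3CornerCone
import Summits.CriticalPhenomena.PercolationContinuityZ3.Theorems.Transplant.FKConnectivityAllQPat3LevelsC
import HarnessLib

/-!
# Connectivity correlation inequalities for `φ_{w,q}`, every `q > 0` — ONE MARKED PIECE ON AN EXPLICIT SKELETON: the
# levelwise value of a two-level table on the composite as a computable sum (census g39 §11 (ii)–(iii), the `t = 1` shapes:
# bridge 𝒯₂-rows B1/B2, wheel and torso 𝒯₂-rows)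

Definitions + theorems file (`--supports stmt-CriticalPhenomena-4575`), census lineage (gen 40) of LANE 2's FK sub-programme; builds on
p205010 (kernel theorem, internal audit signed; external expert review pending).  No named facts, no sorries; standard axioms.

A ONE-PIECE SHAPE: injective names `p : ι → V`, a skeleton `L` (list of named edges, realised by `FK.plainSet`), three mark
names `ix, iy, is`, and ONE marked piece `(EQ; u, v, m)` on `VQ` glued at the names `i, j` (`p i = u`, `p j = v`) with mark name
`k` (`p k = m`); every other name lies off the piece's interior.
* `FK.idMat`, `FK.cmat_empty_of_injective`, `FK.sum_plainList_empty` — the edgeless host has the identity matrix; the whole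
  skeleton peels to one term per bit list (`FK.sumBits`).
* `FK.skelCorr`, `FK.skelPat`, `FK.shape1Term` (DEFINITIONS, computable) — the level corrections, the composite patterns and the
  summand of the shape at a skeleton colouring and piece data `(ℓ, P, Q)`.
* **`FK.lev2C_shape1`** (piece read as a MINOR `(EQ, CQ)`, the form census g37's minors recursion consumes) and **`FK.lev2_shape1`**
  (`CQ = ∅`): `lev2C (plainSet p L ∪ EQ) CQ x y s F μ = Σ_{γ ⊆ EQ} sumBits |L| (shape1Term … μ · (apExpC EQ CQ γ) (pat3 (γ ∪ CQ) u v m)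
  (pat3 ((EQ \ γ) ∪ CQ) u v m))`: the piece enters only through its level and its two patterns; everything else is a
  kernel-evaluable fold (`FK.sum_attachPatC` of `…Pat3Attach`, then `FK.sum_plainList_empty`).
* **`FK.lev2_shape0`** / `FK.shape0Val` — the PIECE-FREE case (`t = 0`, an explicit graph: census g39's exact base checks):
  `lev2 (plainSet p L) x y s F μ = shape0Val … (μ + |L| - 2|V|)` — every base check is a `decide` over `d ≤ 2|L| + 1`.
The sibling `…Pat3ShapeOneCone.lean` turns `lev2_shape1` into the product-cone certificate theorem.
[cite: Grimmett2006, §1.4 eq. (1.20) (p. 15); §3.8 (pp. 61–62)]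
-/

namespace Summit.CriticalPhenomena.PercolationContinuityZ3.Theorems

namespace FK

open SimpleGraph Literature.Probability.LatticeModels Literature.Probability.Percolation
open scoped Classical

variable {V : Type*}

/-! ### One marked piece on an explicit skeleton: the composite two-level value as a computable sum -/

section ShapeOne

variable [Fintype V] {ι : Type*} [DecidableEq ι]

/-- The identity matrix of the names (the connectivity of the edgeless host, for injective names). [folklore] -/
def idMat (ι : Type*) [DecidableEq ι] : ι → ι → Bool := fun a b => decide (a = b)

omit [Fintype V] in
/-- For injective names the edgeless host's connectivity matrix is the identity matrix. [folklore] -/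
theorem cmat_empty_of_injective {p : ι → V} (hinj : Function.Injective p) : cmat p ∅ = idMat ι := by
  rw [cmat_empty]; funext a b; unfold idMat; exact decide_eq_decide.2 hinj.eq_iff

/-- **The whole skeleton from the edgeless host**: `FK.sum_plainList` with `E₁ = ∅` and injective names — one term per bit
list, matrices folded from the identity matrix, level `2|V| +` the two correction counts. [folklore] -/
theorem sum_plainList_empty {β : Type*} [AddCommMonoid β] {p : ι → V} (hinj : Function.Injective p) (L : List (ι × ι))
    (hL : ∀ e ∈ L, p e.1 ≠ p e.2) (hnd : (L.map (pedge p)).Nodup)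
    (s₀ : ℕ) (g : ℕ → (ι → ι → Bool) → (ι → ι → Bool) → β) :
    ∑ γ ∈ (plainSet p L).powerset, g (apExp (plainSet p L) γ + L.length + s₀) (cmat p γ) (cmat p (plainSet p L \ γ)) =
      sumBits L.length fun bs =>
        g (2 * Fintype.card V + (foldBits (idMat ι) (zipBits L bs)).2 +
              (foldBits (idMat ι) (zipBits L (bs.map (! ·)))).2 + s₀)
          (foldBits (idMat ι) (zipBits L bs)).1 (foldBits (idMat ι) (zipBits L (bs.map (! ·)))).1 := by
  have key := sum_plainList (p := p) L (E₁ := ∅) hL hnd (fun e _ h => by simp at h) s₀ g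
  rw [Finset.empty_union] at key
  rw [key, Finset.powerset_empty, Finset.sum_singleton, Finset.sdiff_self, cmat_empty_of_injective hinj, apExp_empty]


omit [Fintype V] [DecidableEq ι] in
/-- `sumBits` of the zero summand. [folklore] -/
theorem sumBits_zero (n : ℕ) : sumBits n (fun _ => (0 : ℤ)) = 0 := by
  induction n with
  | zero => rfl
  | succ n ih => show sumBits n (fun _ => (0 : ℤ)) + sumBits n (fun _ => (0 : ℤ)) = 0; rw [ih]; rfl

omit [Fintype V] [DecidableEq ι] in
/-- `sumBits` of a pointwise-zero summand. [folklore] -/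
theorem sumBits_eq_zero' (n : ℕ) {f : List Bool → ℤ} (h : ∀ bs, f bs = 0) : sumBits n f = 0 := by
  rw [show f = fun _ => 0 from funext h]; exact sumBits_zero n

/-- Reading a three-mark pattern off a connectivity matrix at the names `ix, iy, is`. [folklore] -/
def rdPat (ix iy is : ι) (M : ι → ι → Bool) : Pat3 := Pat3.ofBits (M ix iy) (M ix is) (M iy is)

/-- **Level corrections of a one-piece shape** at skeleton colouring `bs` and piece patterns `(P, Q)`: the cycle-closing
skeleton edges on both sides plus `1{terminals already joined ∧ P.xy}` on both sides. [folklore] -/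
def skelCorr (L : List (ι × ι)) (i j : ι) (bs : List Bool) (P Q : Pat3) : ℕ :=
  (foldBits (idMat ι) (zipBits L bs)).2 + (if (foldBits (idMat ι) (zipBits L bs)).1 i j && P.xy then 1 else 0) +
    ((foldBits (idMat ι) (zipBits L (bs.map (! ·)))).2 +
      (if (foldBits (idMat ι) (zipBits L (bs.map (! ·)))).1 i j && Q.xy then 1 else 0))

/-- **Composite patterns of a one-piece shape** at skeleton colouring `bs` and piece pattern `P` (configuration side; the
complement side is the same function at the negated bits and `Q`). [folklore] -/
def skelPat (L : List (ι × ι)) (i j k ix iy is : ι) (bs : List Bool) (P : Pat3) : Pat3 :=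
  rdPat ix iy is (attachPat (foldBits (idMat ι) (zipBits L bs)).1 i j k P)

/-- **The summand of a one-piece shape** at skeleton colouring `bs`, piece data `(ℓ, P, Q)` (level, pattern, complement pattern)
and target level `μ`: the two-level table `F` read at the composite patterns when the levels match (`|L|` = the number of
skeleton edges absorbs the one-edge networks' exponents). [folklore] -/
def shape1Term (L : List (ι × ι)) (i j k ix iy is : ι) (F : ℕ → Pat3 → Pat3 → ℤ) (μ : ℕ) (bs : List Bool)
    (ℓ : ℕ) (P Q : Pat3) : ℤ :=
  (if ℓ + skelCorr L i j bs P Q = μ + L.length then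
      F 0 (skelPat L i j k ix iy is bs P) (skelPat L i j k ix iy is (bs.map (! ·)) Q) else 0) +
    (if ℓ + skelCorr L i j bs P Q + 1 = μ + L.length then
      F 1 (skelPat L i j k ix iy is bs P) (skelPat L i j k ix iy is (bs.map (! ·)) Q) else 0)

variable {p : ι → V} {L : List (ι × ι)} {EQ : Finset (Sym2 V)} {VQ : Set V} {u v m x y s : V} {i j k ix iy is : ι}

/-- **THE TWO-LEVEL VALUE OF A ONE-PIECE SHAPE, PIECE READ AS A MINOR** (explicit skeleton `L` on injective names + one
marked piece `(EQ, CQ; u, v, m)` on `VQ` — free edges `EQ`, contracted edges `CQ` — glued at the names `i, j`, mark name `k`; marks read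
at the names `ix, iy, is`; all names off the piece's interior except `k`): `lev2C` of the composite minor `(plainSet p L ∪ EQ, CQ)` at
level `μ` is the sum over the piece's configurations `γ` and the skeleton colourings `bs` of `FK.shape1Term` at
`(apExpC EQ CQ γ, pat3 (γ ∪ CQ) u v m, pat3 ((EQ \ γ) ∪ CQ) u v m)` — `FK.sum_attachPatC` then `FK.sum_plainList_empty`.  This is the
form census g37's minors recursion consumes (a minor of a shape with the skeleton intact). [folklore] -/
theorem lev2C_shape1 {CQ : Finset (Sym2 V)} (hinj : Function.Injective p)
    (hQ : ∀ e ∈ (↑(EQ ∪ CQ) : Set (Sym2 V)), ∀ z ∈ e, z ∈ VQ) (huv : u ≠ v)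
    (hmQ : m ∈ VQ) (hmu : m ≠ u) (hmv : m ≠ v) (hp : ∀ a, p a ∈ VQ → p a = u ∨ p a = v ∨ p a = m)
    (hi : p i = u) (hj : p j = v) (hk : p k = m) (hx : p ix = x) (hy : p iy = y) (hs : p is = s)
    (hL : ∀ e ∈ L, p e.1 ≠ p e.2) (hnd : (L.map (pedge p)).Nodup) (hLm : ∀ e ∈ L, p e.1 ≠ m ∧ p e.2 ≠ m)
    (hdQ : Disjoint (plainSet p L) EQ) (F : ℕ → Pat3 → Pat3 → ℤ) (μ : ℕ) :
    lev2C (plainSet p L ∪ EQ) CQ x y s F μ =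
      ∑ γ ∈ EQ.powerset, sumBits L.length fun bs =>
        shape1Term L i j k ix iy is F μ bs (apExpC EQ CQ γ) (pat3 (γ ∪ CQ) u v m) (pat3 (EQ \ γ ∪ CQ) u v m) := by
  -- the host (skeleton) lives off the piece's interior
  have hm : m ∉ ({z | z ∈ VQ → z = u ∨ z = v} : Set V) := fun h => (h hmQ).elim hmu hmv
  have h₁ : ∀ e ∈ (↑(plainSet p L) : Set (Sym2 V)), ∀ z ∈ e, z ∈ ({z | z ∈ VQ → z = u ∨ z = v} : Set V) := by
    intro e he z hz hzQ
    rw [Finset.mem_coe] at he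
    unfold plainSet at he
    rw [List.mem_toFinset, List.mem_map] at he
    obtain ⟨f, hf, rfl⟩ := he
    have hz' : z = p f.1 ∨ z = p f.2 := Sym2.mem_iff.1 hz
    rcases hz' with rfl | rfl
    · rcases hp f.1 hzQ with h | h | h
      · exact Or.inl h
      · exact Or.inr h
      · exact absurd h (hLm f hf).1
    · rcases hp f.2 hzQ with h | h | h
      · exact Or.inl h
      · exact Or.inr h
      · exact absurd h (hLm f hf).2
  have hS : ({z | z ∈ VQ → z = u ∨ z = v} : Set V) ∩ VQ ⊆ {u, v} := fun z hz => hz.1 hz.2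
  -- step 0: `lev2C` as a configuration sum read on the matrices, level shifted by `2|V| + |L|`
  unfold lev2C
  rw [Finset.sum_congr rfl fun γ _ => show
      ((if apExpC (plainSet p L ∪ EQ) CQ γ = μ then
          F 0 (pat3 (γ ∪ CQ) x y s) (pat3 ((plainSet p L ∪ EQ) \ γ ∪ CQ) x y s) else 0) +
        (if apExpC (plainSet p L ∪ EQ) CQ γ + 1 = μ then
          F 1 (pat3 (γ ∪ CQ) x y s) (pat3 ((plainSet p L ∪ EQ) \ γ ∪ CQ) x y s) else 0)) =
      ((if apExpC (plainSet p L ∪ EQ) CQ γ + 2 * Fintype.card V + L.length = μ + 2 * Fintype.card V + L.length then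
          F 0 (rdPat ix iy is (cmat p (γ ∪ CQ))) (rdPat ix iy is (cmat p ((plainSet p L ∪ EQ) \ γ ∪ CQ))) else 0) +
        (if apExpC (plainSet p L ∪ EQ) CQ γ + 2 * Fintype.card V + L.length + 1 = μ + 2 * Fintype.card V + L.length then
          F 1 (rdPat ix iy is (cmat p (γ ∪ CQ))) (rdPat ix iy is (cmat p ((plainSet p L ∪ EQ) \ γ ∪ CQ))) else 0)) by
    simp only [rdPat, ← pat3_eq_ofBits_cmat p _ hx hy hs]
    rw [ite_eq_ite_of_iff (show apExpC (plainSet p L ∪ EQ) CQ γ = μ ↔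
        apExpC (plainSet p L ∪ EQ) CQ γ + 2 * Fintype.card V + L.length = μ + 2 * Fintype.card V + L.length by omega) rfl,
      ite_eq_ite_of_iff (show apExpC (plainSet p L ∪ EQ) CQ γ + 1 = μ ↔
        apExpC (plainSet p L ∪ EQ) CQ γ + 2 * Fintype.card V + L.length + 1 = μ + 2 * Fintype.card V + L.length by omega)
        rfl]]
  -- step 1: peel the piece
  rw [sum_attachPatC hdQ h₁ hQ hS huv hm hmu hmv hp hi hj hk L.length (fun n A B =>
      (if n = μ + 2 * Fintype.card V + L.length then F 0 (rdPat ix iy is A) (rdPat ix iy is B) else 0) +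
        (if n + 1 = μ + 2 * Fintype.card V + L.length then F 1 (rdPat ix iy is A) (rdPat ix iy is B) else 0)),
    Finset.sum_comm]
  refine Finset.sum_congr rfl fun γ hγ => ?_
  -- step 2: peel the skeleton down to the edgeless host
  rw [Finset.sum_congr rfl fun γ₁ _ => show
      ((if apExp (plainSet p L) γ₁ + apExpC EQ CQ γ + (if cmat p γ₁ i j && (pat3 (γ ∪ CQ) u v m).xy then 1 else 0) +
            (if cmat p (plainSet p L \ γ₁) i j && (pat3 (EQ \ γ ∪ CQ) u v m).xy then 1 else 0) + L.length =
            μ + 2 * Fintype.card V + L.length then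
          F 0 (rdPat ix iy is (attachPat (cmat p γ₁) i j k (pat3 (γ ∪ CQ) u v m)))
            (rdPat ix iy is (attachPat (cmat p (plainSet p L \ γ₁)) i j k (pat3 (EQ \ γ ∪ CQ) u v m))) else 0) +
        (if apExp (plainSet p L) γ₁ + apExpC EQ CQ γ + (if cmat p γ₁ i j && (pat3 (γ ∪ CQ) u v m).xy then 1 else 0) +
            (if cmat p (plainSet p L \ γ₁) i j && (pat3 (EQ \ γ ∪ CQ) u v m).xy then 1 else 0) + L.length + 1 =
            μ + 2 * Fintype.card V + L.length then
          F 1 (rdPat ix iy is (attachPat (cmat p γ₁) i j k (pat3 (γ ∪ CQ) u v m)))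
            (rdPat ix iy is (attachPat (cmat p (plainSet p L \ γ₁)) i j k (pat3 (EQ \ γ ∪ CQ) u v m))) else 0)) =
      ((if apExp (plainSet p L) γ₁ + L.length + apExpC EQ CQ γ +
            (if cmat p γ₁ i j && (pat3 (γ ∪ CQ) u v m).xy then 1 else 0) +
            (if cmat p (plainSet p L \ γ₁) i j && (pat3 (EQ \ γ ∪ CQ) u v m).xy then 1 else 0) =
            μ + 2 * Fintype.card V + L.length then
          F 0 (rdPat ix iy is (attachPat (cmat p γ₁) i j k (pat3 (γ ∪ CQ) u v m)))
            (rdPat ix iy is (attachPat (cmat p (plainSet p L \ γ₁)) i j k (pat3 (EQ \ γ ∪ CQ) u v m))) else 0) +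
        (if apExp (plainSet p L) γ₁ + L.length + apExpC EQ CQ γ +
            (if cmat p γ₁ i j && (pat3 (γ ∪ CQ) u v m).xy then 1 else 0) +
            (if cmat p (plainSet p L \ γ₁) i j && (pat3 (EQ \ γ ∪ CQ) u v m).xy then 1 else 0) + 1 =
            μ + 2 * Fintype.card V + L.length then
          F 1 (rdPat ix iy is (attachPat (cmat p γ₁) i j k (pat3 (γ ∪ CQ) u v m)))
            (rdPat ix iy is (attachPat (cmat p (plainSet p L \ γ₁)) i j k (pat3 (EQ \ γ ∪ CQ) u v m))) else 0)) by
    rw [ite_eq_ite_of_iff (show apExp (plainSet p L) γ₁ + apExpC EQ CQ γ +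
            (if cmat p γ₁ i j && (pat3 (γ ∪ CQ) u v m).xy then 1 else 0) +
            (if cmat p (plainSet p L \ γ₁) i j && (pat3 (EQ \ γ ∪ CQ) u v m).xy then 1 else 0) + L.length =
            μ + 2 * Fintype.card V + L.length ↔
          apExp (plainSet p L) γ₁ + L.length + apExpC EQ CQ γ +
            (if cmat p γ₁ i j && (pat3 (γ ∪ CQ) u v m).xy then 1 else 0) +
            (if cmat p (plainSet p L \ γ₁) i j && (pat3 (EQ \ γ ∪ CQ) u v m).xy then 1 else 0) =
            μ + 2 * Fintype.card V + L.length by omega) rfl,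
      ite_eq_ite_of_iff (show apExp (plainSet p L) γ₁ + apExpC EQ CQ γ +
            (if cmat p γ₁ i j && (pat3 (γ ∪ CQ) u v m).xy then 1 else 0) +
            (if cmat p (plainSet p L \ γ₁) i j && (pat3 (EQ \ γ ∪ CQ) u v m).xy then 1 else 0) + L.length + 1 =
            μ + 2 * Fintype.card V + L.length ↔
          apExp (plainSet p L) γ₁ + L.length + apExpC EQ CQ γ +
            (if cmat p γ₁ i j && (pat3 (γ ∪ CQ) u v m).xy then 1 else 0) +
            (if cmat p (plainSet p L \ γ₁) i j && (pat3 (EQ \ γ ∪ CQ) u v m).xy then 1 else 0) + 1 =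
            μ + 2 * Fintype.card V + L.length by omega) rfl],
    sum_plainList_empty hinj L hL hnd (apExpC EQ CQ γ) (fun n A B =>
      (if n + (if A i j && (pat3 (γ ∪ CQ) u v m).xy then 1 else 0) + (if B i j && (pat3 (EQ \ γ ∪ CQ) u v m).xy then 1 else 0) =
          μ + 2 * Fintype.card V + L.length then
        F 0 (rdPat ix iy is (attachPat A i j k (pat3 (γ ∪ CQ) u v m))) (rdPat ix iy is (attachPat B i j k (pat3 (EQ \ γ ∪ CQ) u v m)))
        else 0) +
      (if n + (if A i j && (pat3 (γ ∪ CQ) u v m).xy then 1 else 0) + (if B i j && (pat3 (EQ \ γ ∪ CQ) u v m).xy then 1 else 0) + 1 =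
          μ + 2 * Fintype.card V + L.length then
        F 1 (rdPat ix iy is (attachPat A i j k (pat3 (γ ∪ CQ) u v m))) (rdPat ix iy is (attachPat B i j k (pat3 (EQ \ γ ∪ CQ) u v m)))
        else 0))]
  -- step 3: the summands agree (the `2|V|` cancels)
  congr 1
  funext bs
  unfold shape1Term skelPat skelCorr
  rw [ite_eq_ite_of_iff (show 2 * Fintype.card V + (foldBits (idMat ι) (zipBits L bs)).2 +
          (foldBits (idMat ι) (zipBits L (bs.map (! ·)))).2 + apExpC EQ CQ γ +
          (if (foldBits (idMat ι) (zipBits L bs)).1 i j && (pat3 (γ ∪ CQ) u v m).xy then 1 else 0) +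
          (if (foldBits (idMat ι) (zipBits L (bs.map (! ·)))).1 i j && (pat3 (EQ \ γ ∪ CQ) u v m).xy then 1 else 0) =
          μ + 2 * Fintype.card V + L.length ↔
        apExpC EQ CQ γ + ((foldBits (idMat ι) (zipBits L bs)).2 +
          (if (foldBits (idMat ι) (zipBits L bs)).1 i j && (pat3 (γ ∪ CQ) u v m).xy then 1 else 0) +
          ((foldBits (idMat ι) (zipBits L (bs.map (! ·)))).2 +
            (if (foldBits (idMat ι) (zipBits L (bs.map (! ·)))).1 i j && (pat3 (EQ \ γ ∪ CQ) u v m).xy then 1 else 0))) =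
          μ + L.length by omega) rfl,
    ite_eq_ite_of_iff (show 2 * Fintype.card V + (foldBits (idMat ι) (zipBits L bs)).2 +
          (foldBits (idMat ι) (zipBits L (bs.map (! ·)))).2 + apExpC EQ CQ γ +
          (if (foldBits (idMat ι) (zipBits L bs)).1 i j && (pat3 (γ ∪ CQ) u v m).xy then 1 else 0) +
          (if (foldBits (idMat ι) (zipBits L (bs.map (! ·)))).1 i j && (pat3 (EQ \ γ ∪ CQ) u v m).xy then 1 else 0) + 1 =
          μ + 2 * Fintype.card V + L.length ↔
        apExpC EQ CQ γ + ((foldBits (idMat ι) (zipBits L bs)).2 +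
          (if (foldBits (idMat ι) (zipBits L bs)).1 i j && (pat3 (γ ∪ CQ) u v m).xy then 1 else 0) +
          ((foldBits (idMat ι) (zipBits L (bs.map (! ·)))).2 +
            (if (foldBits (idMat ι) (zipBits L (bs.map (! ·)))).1 i j && (pat3 (EQ \ γ ∪ CQ) u v m).xy then 1 else 0))) + 1 =
          μ + L.length by omega) rfl]

/-- **THE TWO-LEVEL VALUE OF A ONE-PIECE SHAPE** (nothing contracted): `FK.lev2C_shape1` with `CQ = ∅`. [folklore] -/
theorem lev2_shape1 (hinj : Function.Injective p) (hQ : ∀ e ∈ (↑EQ : Set (Sym2 V)), ∀ z ∈ e, z ∈ VQ) (huv : u ≠ v)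
    (hmQ : m ∈ VQ) (hmu : m ≠ u) (hmv : m ≠ v) (hp : ∀ a, p a ∈ VQ → p a = u ∨ p a = v ∨ p a = m)
    (hi : p i = u) (hj : p j = v) (hk : p k = m) (hx : p ix = x) (hy : p iy = y) (hs : p is = s)
    (hL : ∀ e ∈ L, p e.1 ≠ p e.2) (hnd : (L.map (pedge p)).Nodup) (hLm : ∀ e ∈ L, p e.1 ≠ m ∧ p e.2 ≠ m)
    (hdQ : Disjoint (plainSet p L) EQ) (F : ℕ → Pat3 → Pat3 → ℤ) (μ : ℕ) :
    lev2 (plainSet p L ∪ EQ) x y s F μ =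
      ∑ γ ∈ EQ.powerset, sumBits L.length fun bs =>
        shape1Term L i j k ix iy is F μ bs (apExp EQ γ) (pat3 γ u v m) (pat3 (EQ \ γ) u v m) := by
  have key := lev2C_shape1 (CQ := ∅) hinj (by rwa [Finset.union_empty]) huv hmQ hmu hmv hp hi hj hk hx hy hs hL hnd hLm hdQ F μ
  rw [lev2C_empty] at key
  rw [key]
  simp only [Finset.union_empty, apExpC_empty]

/-- **The value of a PIECE-FREE shape** (an explicit graph on injective names, `t = 0`: the base checks) at residual level
`d` (= level `+ |L| - 2|V|`): the table read on the folded matrices over all colourings with `d` corrections. Computable. [folklore] -/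
def shape0Val (L : List (ι × ι)) (ix iy is : ι) (F : ℕ → Pat3 → Pat3 → ℤ) (d : ℕ) : ℤ :=
  sumBits L.length fun bs =>
    (if (foldBits (idMat ι) (zipBits L bs)).2 + (foldBits (idMat ι) (zipBits L (bs.map (! ·)))).2 = d then
        F 0 (rdPat ix iy is (foldBits (idMat ι) (zipBits L bs)).1) (rdPat ix iy is (foldBits (idMat ι) (zipBits L (bs.map (! ·)))).1)
      else 0) +
      (if (foldBits (idMat ι) (zipBits L bs)).2 + (foldBits (idMat ι) (zipBits L (bs.map (! ·)))).2 + 1 = d then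
        F 1 (rdPat ix iy is (foldBits (idMat ι) (zipBits L bs)).1) (rdPat ix iy is (foldBits (idMat ι) (zipBits L (bs.map (! ·)))).1)
      else 0)

/-- **THE TWO-LEVEL VALUE OF AN EXPLICIT GRAPH** (`t = 0`: census g39's «exact base checks», e.g. the bridge row B0 and the torso
rows with the inner mark at a vertex): `lev2 (plainSet p L) x y s F μ` is `shape0Val` at the residual level `μ + |L| - 2|V|`
(and vanishes below `2|V| - |L|`) — computable, so every base check is a `decide` over the residual levels `d ≤ 2|L| + 1`. [folklore] -/
theorem lev2_shape0 (hinj : Function.Injective p) (hx : p ix = x) (hy : p iy = y) (hs : p is = s)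
    (hL : ∀ e ∈ L, p e.1 ≠ p e.2) (hnd : (L.map (pedge p)).Nodup) (F : ℕ → Pat3 → Pat3 → ℤ) (μ : ℕ) :
    lev2 (plainSet p L) x y s F μ =
      if 2 * Fintype.card V ≤ μ + L.length then shape0Val L ix iy is F (μ + L.length - 2 * Fintype.card V) else 0 := by
  unfold lev2
  rw [Finset.sum_congr rfl fun γ _ => show
      ((if apExp (plainSet p L) γ = μ then F 0 (pat3 γ x y s) (pat3 (plainSet p L \ γ) x y s) else 0) +
        (if apExp (plainSet p L) γ + 1 = μ then F 1 (pat3 γ x y s) (pat3 (plainSet p L \ γ) x y s) else 0)) =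
      ((if apExp (plainSet p L) γ + L.length + 0 = μ + L.length then
          F 0 (rdPat ix iy is (cmat p γ)) (rdPat ix iy is (cmat p (plainSet p L \ γ))) else 0) +
        (if apExp (plainSet p L) γ + L.length + 0 + 1 = μ + L.length then
          F 1 (rdPat ix iy is (cmat p γ)) (rdPat ix iy is (cmat p (plainSet p L \ γ))) else 0)) by
    simp only [rdPat, ← pat3_eq_ofBits_cmat p _ hx hy hs]
    rw [ite_eq_ite_of_iff (show apExp (plainSet p L) γ = μ ↔ apExp (plainSet p L) γ + L.length + 0 = μ + L.length by omega)
        rfl,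
      ite_eq_ite_of_iff (show apExp (plainSet p L) γ + 1 = μ ↔
        apExp (plainSet p L) γ + L.length + 0 + 1 = μ + L.length by omega) rfl],
    sum_plainList_empty hinj L hL hnd 0 (fun n A B =>
      (if n = μ + L.length then F 0 (rdPat ix iy is A) (rdPat ix iy is B) else 0) +
        (if n + 1 = μ + L.length then F 1 (rdPat ix iy is A) (rdPat ix iy is B) else 0))]
  unfold shape0Val
  split_ifs with h
  · congr 1
    funext bs
    rw [ite_eq_ite_of_iff (show 2 * Fintype.card V + (foldBits (idMat ι) (zipBits L bs)).2 +
          (foldBits (idMat ι) (zipBits L (bs.map (! ·)))).2 + 0 = μ + L.length ↔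
        (foldBits (idMat ι) (zipBits L bs)).2 + (foldBits (idMat ι) (zipBits L (bs.map (! ·)))).2 =
          μ + L.length - 2 * Fintype.card V by omega) rfl,
      ite_eq_ite_of_iff (show 2 * Fintype.card V + (foldBits (idMat ι) (zipBits L bs)).2 +
          (foldBits (idMat ι) (zipBits L (bs.map (! ·)))).2 + 0 + 1 = μ + L.length ↔
        (foldBits (idMat ι) (zipBits L bs)).2 + (foldBits (idMat ι) (zipBits L (bs.map (! ·)))).2 + 1 =
          μ + L.length - 2 * Fintype.card V by omega) rfl]
  · refine sumBits_eq_zero' L.length fun bs => ?_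
    have e1 : ¬ (2 * Fintype.card V + (foldBits (idMat ι) (zipBits L bs)).2 +
        (foldBits (idMat ι) (zipBits L (bs.map (! ·)))).2 + 0 = μ + L.length) := by omega
    have e2 : ¬ (2 * Fintype.card V + (foldBits (idMat ι) (zipBits L bs)).2 +
        (foldBits (idMat ι) (zipBits L (bs.map (! ·)))).2 + 0 + 1 = μ + L.length) := by omega
    rw [if_neg e1, if_neg e2, add_zero]

end ShapeOne

end FK

end Summit.CriticalPhenomena.PercolationContinuityZ3.Theorems
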